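import Mathlib.MeasureTheory.Measure.Haar.InnerProductSpace
import Mathlib.Analysis.Normed.Lp.MeasurableSpace
import Mathlib.MeasureTheory.Measure.Lebesgue.Basic
import Literature.Analysis.Convexity.AnisotropicPerimeterSeparated
import Literature.MathematicalPhysics.StatisticalMechanics.FiniteRangeLatticeGammaLimit
import HarnessLib

/-!
# Del Nin–Petrache 2022, Proposition 1.2 (compactness) and Theorem 1.1 (`Γ`-liminf) are FALSE as printed
# and as typed: one-dimensional counterexamples (the zero potential; equidistributed combs; a dyadic
# staircase of infinite perimeter)

Topic `Literature/MathematicalPhysics/StatisticalMechanics` (namespace = path, grouping sub-namespace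
`DelNinPetrache2022` as in the companion file `FiniteRangeLatticeGammaLimit.lean`, which types
G. Del Nin, M. Petrache, *Continuum limits of discrete isoperimetric problems and Wulff shapes in
lattices and quasicrystal tilings*, Calc. Var. PDE **61** (2022) no. 226 = arXiv:2101.11977
[DelNinPetrache2022]; held text `paper:arxiv-2101.11977`, chunks `p0003`, `p0011`).
Cross-ladder literature-typing layer (D-0088 (4)), cell `crystal3d-full`, seat `littype-FC1-1`
(gen 12): Literature-honesty record (D-0014).

## The discrepancy

The source's standing hypothesis (§1.1, p. 3) is "`V : 𝓛 → (−∞, 0]` … vanishes outside of a finite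
subset `𝒩 ⊂ 𝓛` such that `span_ℤ 𝒩 = 𝓛`", and **Proposition 1.2 (Compactness)** (p. 3–4) reads
"Suppose that `span_ℤ 𝒩 = 𝓛`. Given a sequence `X_N` such that `𝓕(X_N) ≤ C N^{(d−1)/d}` there exists a
subsequence `X_{N_k}` and a finite perimeter set `E` such that `E_{N_k}(X_{N_k}) → E` in `L¹_loc`."
Read literally — and this is exactly how `IsFiniteRangePotential` /
`DelNinPetrache2022_compactness` transcribe it — nothing forces `V` to be NON-ZERO on `𝒩`: the zero
potential `V ≡ 0` with `𝒩` = a lattice basis satisfies every hypothesis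
(`isFiniteRangePotential_zero`).  Then `𝓕 ≡ 0`, so EVERY sequence of configurations obeys the
energy bound, and compactness fails: in `d = 1`, `𝓛 = ℤ`, the configurations
`X_n = {0, 2, 4, …, 2n − 2}` have rescaled cell sets `E_n(X_n) = ⋃_{j<n} [2j/n, (2j+1)/n)` — combs of
`n` teeth equidistributed in `[0, 2)` (`cellSet_combConfig`) — whose traces on every subinterval of
`[0,2)` have density `→ 1/2` (`comb_equidistribution`), so that two combs of orders `n ≤ m/4` are at
`L¹[0,2]`-distance `≥ 1/2` (`one_le_add_volume_comb_symmDiff`) and no subsequence is Cauchy, let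
alone locally convergent in measure (`not_tendsto_volume_comb_symmDiff`).  Hence
**`compactness_false : ¬ DelNinPetrache2022_compactness`** (`§5`).  The printed PROOF is fine: its
Lemma 2.5 (p. 11) explicitly assumes "`V(v) < 0` for every `v ∈ 𝒩`" (then
`P(E_N(X_N)) ≤ K 𝓕(X_N)` and the standard compactness of finite-perimeter sets applies); it is the
printed STATEMENT (and §1.1) that omit this clause.  The corrected statement — Proposition 1.2 with
the hypothesis of Lemma 2.5 — is recorded as the named fact `DelNinPetrache2022_compactness'` in
the companion file (append of the same date), together with the same repair of the `Γ`-liminf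
clause of Theorem 1.1 (`DelNinPetrache2022_liminf`, false by the same loophole: with `V ≡ 0` an
`L¹_loc`-limit of cell sets of infinite perimeter gives `⊤ ≤ 0`) and a note on Corollary 1.3
(`DelNinPetrache2022_minimizers`, which as printed/typed holds vacuously via escaping translations).

**The `Γ`-liminf clause (append, same seat and date).**  `DelNinPetrache2022_liminf` (Theorem 1.1,
liminf inequality, as typed over the same `IsFiniteRangePotential`) fails by the same loophole: with
`V ≡ 0` its right-hand side `liminf_k N_k^{−(d−1)/d} 𝓕(X_k)` is `0` along EVERY sequence, while its
left-hand side `crystallinePerimeter φ_V E` is `⊤` as soon as the local limit `E` is NOT a set of finite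
perimeter — and such limits exist: in `d = 1` the bounded "dyadic staircase"
`E = {x : x 0 ∈ ⋃_{i≥0} [2^{−i−1}, (5/4)·2^{−i−1})}` (`badSet`) has infinite perimeter (§7: each slab
`{a ≤ x 0 < b}` has perimeter `≥ 1`, tested against a smooth bump field and evaluated by the
fundamental theorem of calculus, §6; the first `m` steps are pairwise separated and separated from the
rest, so the perimeter is additive over them by the tree's
`perimeter_biUnion_eq_sum_of_disjoint_closure` / `perimeter_union_eq_add_of_disjoint_closure`), and it
is the local-in-measure limit of the rescaled cell sets of the configurations `X_k ⊂ ℤ`,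
`#X_k = N_k = 2^{k+2}`, made of the `2^k − 1` dyadic cells tiling the first `k` steps plus `3·2^k + 1`
padding cells beyond `N_k²` (which leave every bounded window; §8).  Hence
**`liminf_false : ¬ DelNinPetrache2022_liminf`** (§9).  Again the printed proof (§2.3 with Lemma 2.5) is
fine for potentials with `V < 0` on `𝒩`; the corrected statement is `DelNinPetrache2022_liminf'`.

Everything below is PROVED (no named fact, no `sorry`); the real-line parts (§1–§3, §7–§8) are
elementary measure theory of intervals, the transport to `EuclideanSpace ℝ (Fin 1)` (§4, §6) uses the
volume-preserving `WithLp` identification of Mathlib, and §6–§7 use the tree's distributional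
perimeter (`FccTexturedSet.lean`) and its additivity over separated sets
(`AnisotropicPerimeterSeparated.lean`).

## Contents

* §1 `tooth`, `gap`, `comb`, `cocomb`, `block`: the comb `⋃_{j<m} [2j/m,(2j+1)/m)` and its complement in
  `[0,2)`; measurability, volumes, `comb ∪ cocomb = [0,2)` (`comb_union_cocomb`), disjointness.
* §2 `comb_equidistribution`: `|2·vol(comb_m ∩ [a,b)) − (b−a)| ≤ 1/m` for `[a,b) ⊆ [0,2)` (the cocomb is
  the `1/m`-translate of the comb).
* §3 `one_le_add_volume_comb_symmDiff`: `1 ≤ n/m + vol((comb_n Δ comb_m) ∩ [0,2))`;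
  `not_tendsto_volume_comb_symmDiff`: for NO set `G ⊆ ℝ` and no strictly increasing `n_k` does
  `vol((comb_{n_k} Δ G) ∩ [0,2]) → 0` (outer measure; `G` arbitrary).
* §4 `coord : ℝ¹ ≃ᵐ ℝ` (volume preserving), the data `idMap`, `unitVec`, `combConfig`,
  `isFiniteRangePotential_zero`, `surfaceEnergy_zero_potential`, `cellSet_combConfig`.
* §5 `compactness_false`, alias `DelNinPetrache2022_compactness_false`.
* §6 `slab a b = {a ≤ x 0 < b}`; `one_le_perimeter_slab` (private): `1 ≤ Per(slab a b)` for `a < b`.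
* §7 `lEnd`, `rEnd`, `step`, `staircase`, `badSet`; `natCast_le_perimeter_badSet`, `perimeter_badSet = ⊤`,
  `not_hasFinitePerimeter_badSet` (private).
* §8 `scaleOf k = 2^{k+2}`, `natConfig`, `cellSet_natConfig` (rescaled cell set of natural-number sites),
  `nearIdx`, `farIdx`, `idx`, `staircaseConfig` (exactly `N_k` sites), `locallyConvergesInMeasure_staircase`.
* §9 `liminf_false`, alias `DelNinPetrache2022_liminf_false`.

WHAT THIS IS NOT: a defect of the paper's mathematics (Lemma 2.5 + [AFP] prove the intended
statements); not a statement about `DelNinPetrache2022_limsup` (unaffected by the loophole).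
-/

noncomputable section

open scoped Topology ENNReal symmDiff
open Filter Set MeasureTheory Metric

namespace Literature.MathematicalPhysics.StatisticalMechanics.DelNinPetrache2022

/-! ### §1 The comb `⋃_{j<m} [2j/m, (2j+1)/m)` on the real line -/

/-- The `j`-th tooth `[2j/m, (2j+1)/m)` of the comb of order `m`. [folklore] -/
def tooth (m j : ℕ) : Set ℝ := Ico ((2 * (j : ℝ)) / m) ((2 * (j : ℝ) + 1) / m)

/-- The `j`-th gap `[(2j+1)/m, (2j+2)/m)` of the comb of order `m`. [folklore] -/
def gap (m j : ℕ) : Set ℝ := Ico ((2 * (j : ℝ) + 1) / m) ((2 * (j : ℝ) + 2) / m)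

/-- The comb of order `m`: `⋃_{j<m} [2j/m, (2j+1)/m) ⊆ [0, 2)` — `m` teeth of width `1/m`, total
length `1`, equidistributed in `[0,2)`. [folklore] -/
def comb (m : ℕ) : Set ℝ := ⋃ j ∈ Finset.range m, tooth m j

/-- The complementary comb `⋃_{j<m} [(2j+1)/m, (2j+2)/m)`. [folklore] -/
def cocomb (m : ℕ) : Set ℝ := ⋃ j ∈ Finset.range m, gap m j

/-- Helper. [folklore] -/
private theorem measurableSet_tooth (m j : ℕ) : MeasurableSet (tooth m j) := measurableSet_Ico

/-- Helper. [folklore] -/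
private theorem measurableSet_gap (m j : ℕ) : MeasurableSet (gap m j) := measurableSet_Ico

/-- Helper. [folklore] -/
private theorem measurableSet_comb (m : ℕ) : MeasurableSet (comb m) :=
  MeasurableSet.biUnion (Finset.range m).countable_toSet fun j _ => measurableSet_tooth m j

/-- Helper. [folklore] -/
private theorem measurableSet_cocomb (m : ℕ) : MeasurableSet (cocomb m) :=
  MeasurableSet.biUnion (Finset.range m).countable_toSet fun j _ => measurableSet_gap m j

/-- Helper. [folklore] -/
private theorem volume_tooth {m : ℕ} (hm : 0 < m) (j : ℕ) : volume (tooth m j) = (m : ℝ≥0∞)⁻¹ := by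
  have hm' : (0 : ℝ) < m := by exact_mod_cast hm
  rw [tooth, Real.volume_Ico, show (2 * (j : ℝ) + 1) / m - 2 * (j : ℝ) / m = (m : ℝ)⁻¹ by
    field_simp; ring]
  rw [ENNReal.ofReal_inv_of_pos hm', ENNReal.ofReal_natCast]

/-- Helper. [folklore] -/
private theorem volume_gap {m : ℕ} (hm : 0 < m) (j : ℕ) : volume (gap m j) = (m : ℝ≥0∞)⁻¹ := by
  have hm' : (0 : ℝ) < m := by exact_mod_cast hm
  rw [gap, Real.volume_Ico, show (2 * (j : ℝ) + 2) / m - (2 * (j : ℝ) + 1) / m = (m : ℝ)⁻¹ by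
    field_simp; ring]
  rw [ENNReal.ofReal_inv_of_pos hm', ENNReal.ofReal_natCast]

/-- A gap is the translate by `1/m` of the tooth with the same index. [folklore] -/
private theorem mem_gap_iff {m : ℕ} (hm : 0 < m) (j : ℕ) (x : ℝ) :
    x ∈ gap m j ↔ x - (m : ℝ)⁻¹ ∈ tooth m j := by
  have hm' : (0 : ℝ) < m := by exact_mod_cast hm
  have e1 : (2 * (j : ℝ) + 1) / m = 2 * (j : ℝ) / m + (m : ℝ)⁻¹ := by field_simp
  have e2 : (2 * (j : ℝ) + 2) / m = (2 * (j : ℝ) + 1) / m + (m : ℝ)⁻¹ := by field_simp; ring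
  simp only [gap, tooth, mem_Ico]
  rw [e1, e2]
  constructor <;> rintro ⟨h1, h2⟩ <;> exact ⟨by linarith, by linarith⟩

/-- Helper. [folklore] -/
private theorem mem_cocomb_iff {m : ℕ} (hm : 0 < m) (x : ℝ) :
    x ∈ cocomb m ↔ x - (m : ℝ)⁻¹ ∈ comb m := by
  simp only [cocomb, comb, mem_iUnion, exists_prop, mem_gap_iff hm]

/-- Helper. [folklore] -/
private theorem tooth_subset {m j : ℕ} (hj : j < m) : tooth m j ⊆ Ico (0 : ℝ) 2 := by
  have hm' : (0 : ℝ) < m := by exact_mod_cast (Nat.zero_lt_of_lt hj)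
  intro x hx
  simp only [tooth, mem_Ico] at hx ⊢
  have hj' : (j : ℝ) + 1 ≤ m := by exact_mod_cast hj
  constructor
  · exact le_trans (by positivity) hx.1
  · calc x < (2 * (j : ℝ) + 1) / m := hx.2
      _ ≤ 2 := by rw [div_le_iff₀ hm']; linarith

/-- Helper. [folklore] -/
private theorem gap_subset {m j : ℕ} (hj : j < m) : gap m j ⊆ Ico (0 : ℝ) 2 := by
  have hm' : (0 : ℝ) < m := by exact_mod_cast (Nat.zero_lt_of_lt hj)
  intro x hx
  simp only [gap, mem_Ico] at hx ⊢
  have hj' : (j : ℝ) + 1 ≤ m := by exact_mod_cast hj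
  constructor
  · exact le_trans (by positivity) hx.1
  · calc x < (2 * (j : ℝ) + 2) / m := hx.2
      _ ≤ 2 := by rw [div_le_iff₀ hm']; linarith

/-- Helper. [folklore] -/
private theorem comb_subset (m : ℕ) : comb m ⊆ Ico (0 : ℝ) 2 := by
  intro x hx
  simp only [comb, mem_iUnion, Finset.mem_range, exists_prop] at hx
  obtain ⟨j, hj, hx⟩ := hx
  exact tooth_subset hj hx

/-- Helper. [folklore] -/
private theorem cocomb_subset (m : ℕ) : cocomb m ⊆ Ico (0 : ℝ) 2 := by
  intro x hx
  simp only [cocomb, mem_iUnion, Finset.mem_range, exists_prop] at hx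
  obtain ⟨j, hj, hx⟩ := hx
  exact gap_subset hj hx

/-- Teeth and gaps never meet. [folklore] -/
private theorem disjoint_tooth_gap {m : ℕ} (hm : 0 < m) (j j' : ℕ) : Disjoint (tooth m j) (gap m j') := by
  have hm' : (0 : ℝ) < m := by exact_mod_cast hm
  rw [Set.disjoint_iff]
  intro x ⟨hx, hx'⟩
  simp only [tooth, gap, mem_Ico] at hx hx'
  -- `2j ≤ m x < 2j + 1` and `2j' + 1 ≤ m x < 2j' + 2`
  have h1 : 2 * (j : ℝ) ≤ m * x := by
    have := hx.1; rw [div_le_iff₀ hm'] at this; linarith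
  have h2 : m * x < 2 * (j : ℝ) + 1 := by
    have := hx.2; rw [lt_div_iff₀ hm'] at this; linarith
  have h3 : 2 * (j' : ℝ) + 1 ≤ m * x := by
    have := hx'.1; rw [div_le_iff₀ hm'] at this; linarith
  have h4 : m * x < 2 * (j' : ℝ) + 2 := by
    have := hx'.2; rw [lt_div_iff₀ hm'] at this; linarith
  have h5 : (j : ℤ) ≤ j' := by
    have : (2 * j : ℝ) < 2 * j' + 2 := by linarith
    have : (j : ℤ) < j' + 1 := by exact_mod_cast (by linarith : (j : ℝ) < j' + 1)
    omega
  have h6 : (j' : ℤ) < j := by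
    have : (2 * j' + 1 : ℝ) < 2 * j + 1 := by linarith
    exact_mod_cast (by linarith : (j' : ℝ) < j)
  omega

/-- Helper. [folklore] -/
private theorem disjoint_comb_cocomb {m : ℕ} (hm : 0 < m) : Disjoint (comb m) (cocomb m) := by
  simp only [comb, cocomb, disjoint_iUnion_left, disjoint_iUnion_right]
  exact fun _ _ _ _ => disjoint_tooth_gap hm _ _

/-- Helper. [folklore] -/
private theorem disjoint_comb_gap {m : ℕ} (hm : 0 < m) (j : ℕ) : Disjoint (comb m) (gap m j) := by
  simp only [comb, disjoint_iUnion_left]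
  exact fun j' _ => disjoint_tooth_gap hm j' j

/-- Teeth and gaps tile `[0, 2)`. [folklore] -/
private theorem comb_union_cocomb {m : ℕ} (hm : 0 < m) : comb m ∪ cocomb m = Ico (0 : ℝ) 2 := by
  have hm' : (0 : ℝ) < m := by exact_mod_cast hm
  refine Subset.antisymm (union_subset (comb_subset m) (cocomb_subset m)) fun x hx => ?_
  rw [mem_Ico] at hx
  -- `t = ⌊m x⌋ < 2m`; parity decides tooth / gap
  set t : ℕ := ⌊(m : ℝ) * x⌋₊ with ht
  have hmx : 0 ≤ (m : ℝ) * x := mul_nonneg hm'.le hx.1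
  have ht1 : (t : ℝ) ≤ m * x := Nat.floor_le hmx
  have ht2 : (m : ℝ) * x < t + 1 := Nat.lt_floor_add_one _
  obtain ⟨j, hj | hj⟩ := Nat.even_or_odd' t
  · -- tooth `j`
    have hjm : j < m := by
      have : (t : ℝ) < 2 * m := lt_of_le_of_lt ht1 (by nlinarith [hx.2])
      have : t < 2 * m := by exact_mod_cast this
      omega
    refine Or.inl ?_
    simp only [comb, mem_iUnion, Finset.mem_range, exists_prop]
    refine ⟨j, hjm, ?_⟩
    simp only [tooth, mem_Ico]
    have htj : (t : ℝ) = 2 * j := by rw [hj]; push_cast; ring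
    constructor
    · rw [div_le_iff₀ hm']; linarith
    · rw [lt_div_iff₀ hm']; linarith
  · -- gap `j`
    have hjm : j < m := by
      have : (t : ℝ) < 2 * m := lt_of_le_of_lt ht1 (by nlinarith [hx.2])
      have : t < 2 * m := by exact_mod_cast this
      omega
    refine Or.inr ?_
    simp only [cocomb, mem_iUnion, Finset.mem_range, exists_prop]
    refine ⟨j, hjm, ?_⟩
    simp only [gap, mem_Ico]
    have htj : (t : ℝ) = 2 * j + 1 := by rw [hj]; push_cast; ring
    constructor
    · rw [div_le_iff₀ hm']; linarith
    · rw [lt_div_iff₀ hm']; linarith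


/-- The block `[2j/n, (2j+2)/n)` = tooth `j` ∪ gap `j`. [folklore] -/
def block (n j : ℕ) : Set ℝ := Ico ((2 * (j : ℝ)) / n) ((2 * (j : ℝ) + 2) / n)

/-- Helper. [folklore] -/
private theorem tooth_subset_block (n j : ℕ) : tooth n j ⊆ block n j := by
  intro x hx
  simp only [tooth, block, mem_Ico] at hx ⊢
  rcases Nat.eq_zero_or_pos n with hn | hn
  · subst hn; simp at hx ⊢; exact ⟨hx.1, hx.2⟩
  have hn' : (0 : ℝ) < n := by exact_mod_cast hn
  exact ⟨hx.1, lt_of_lt_of_le hx.2 (by rw [div_le_div_iff_of_pos_right hn']; linarith)⟩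

/-- Helper. [folklore] -/
private theorem gap_subset_block (n j : ℕ) : gap n j ⊆ block n j := by
  intro x hx
  simp only [gap, block, mem_Ico] at hx ⊢
  rcases Nat.eq_zero_or_pos n with hn | hn
  · subst hn; simp at hx ⊢; exact ⟨hx.1, hx.2⟩
  have hn' : (0 : ℝ) < n := by exact_mod_cast hn
  exact ⟨le_trans (by rw [div_le_div_iff_of_pos_right hn']; linarith) hx.1, hx.2⟩

/-- Distinct blocks are disjoint. [folklore] -/
private theorem disjoint_block {n : ℕ} (hn : 0 < n) {j j' : ℕ} (hjj : j ≠ j') :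
    Disjoint (block n j) (block n j') := by
  have hn' : (0 : ℝ) < n := by exact_mod_cast hn
  rw [Set.disjoint_iff]
  intro x ⟨hx, hx'⟩
  simp only [block, mem_Ico] at hx hx'
  have h1 : 2 * (j : ℝ) ≤ n * x := by
    have := hx.1; rw [div_le_iff₀ hn'] at this; linarith
  have h2 : n * x < 2 * (j : ℝ) + 2 := by
    have := hx.2; rw [lt_div_iff₀ hn'] at this; linarith
  have h3 : 2 * (j' : ℝ) ≤ n * x := by
    have := hx'.1; rw [div_le_iff₀ hn'] at this; linarith
  have h4 : n * x < 2 * (j' : ℝ) + 2 := by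
    have := hx'.2; rw [lt_div_iff₀ hn'] at this; linarith
  have h5 : (j : ℤ) < j' + 1 := by exact_mod_cast (by linarith : (j : ℝ) < j' + 1)
  have h6 : (j' : ℤ) < j + 1 := by exact_mod_cast (by linarith : (j' : ℝ) < j + 1)
  exact hjj (by omega)

/-! ### §2 Equidistribution of the comb on subintervals of `[0, 2)` -/

/-- `(m : ℝ≥0∞)⁻¹ = ofReal (m⁻¹)`. [folklore] -/
private theorem ofReal_inv_natCast {m : ℕ} (hm : 0 < m) :
    ENNReal.ofReal ((m : ℝ)⁻¹) = (m : ℝ≥0∞)⁻¹ := by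
  have hm' : (0 : ℝ) < m := by exact_mod_cast hm
  rw [ENNReal.ofReal_inv_of_pos hm', ENNReal.ofReal_natCast]

/-- **Equidistribution of the comb, two-sided.** For `0 ≤ a ≤ b ≤ 2` the comb of order `m ≥ 1`
covers half of `[a, b)` up to an error `1/(2m)`: `2·vol(comb_m ∩ [a,b)) ≤ (b − a) + 1/m` and
`(b − a) ≤ 2·vol(comb_m ∩ [a,b)) + 1/m`.  (The complementary comb is the translate of the comb by
`1/m`, the two tile `[0,2)`, and translating `[a,b)` by `1/m` changes its trace on the comb by at most
`1/m`.) [folklore] -/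
private theorem comb_equidistribution {m : ℕ} (hm : 0 < m) {a b : ℝ} (ha : 0 ≤ a) (hb : b ≤ 2) :
    2 * volume (comb m ∩ Ico a b) ≤ ENNReal.ofReal (b - a) + (m : ℝ≥0∞)⁻¹ ∧
      ENNReal.ofReal (b - a) ≤ 2 * volume (comb m ∩ Ico a b) + (m : ℝ≥0∞)⁻¹ := by
  have hm' : (0 : ℝ) < m := by exact_mod_cast hm
  set h : ℝ := (m : ℝ)⁻¹ with hh
  have hpos : 0 < h := by positivity
  set v := volume (comb m ∩ Ico a b) with hv
  set v' := volume (cocomb m ∩ Ico a b) with hv'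
  -- (1) the two traces add up to `b - a`
  have hsub : Ico a b ⊆ Ico (0 : ℝ) 2 := Ico_subset_Ico ha hb
  have h1 : v + v' = ENNReal.ofReal (b - a) := by
    rw [hv, hv', ← measure_union _ ((measurableSet_cocomb m).inter measurableSet_Ico)]
    · rw [← union_inter_distrib_right, comb_union_cocomb hm, inter_eq_self_of_subset_right hsub,
        Real.volume_Ico]
    · exact Disjoint.mono inter_subset_left inter_subset_left (disjoint_comb_cocomb hm)
  -- (2) the trace on the cocomb is the trace on the comb of the translated interval
  have h2 : v' = volume (comb m ∩ Ico (a - h) (b - h)) := by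
    have hset : cocomb m ∩ Ico a b = (fun x => x + -h) ⁻¹' (comb m ∩ Ico (a - h) (b - h)) := by
      ext x
      simp only [mem_inter_iff, mem_preimage, mem_cocomb_iff hm, mem_Ico, ← sub_eq_add_neg, ← hh]
      constructor
      · rintro ⟨hx, h1, h2⟩; exact ⟨hx, by linarith, by linarith⟩
      · rintro ⟨hx, h1, h2⟩; exact ⟨hx, by linarith, by linarith⟩
    rw [hv', hset, measure_preimage_add_right]
  -- (3) translating the interval changes the trace by at most `h`
  have hvolh : volume (Ico (a - h) a) = ENNReal.ofReal h ∧ volume (Ico (b - h) b) = ENNReal.ofReal h := by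
    constructor <;> rw [Real.volume_Ico] <;> congr 1 <;> ring
  have h3 : volume (comb m ∩ Ico (a - h) (b - h)) ≤ v + ENNReal.ofReal h := by
    calc volume (comb m ∩ Ico (a - h) (b - h))
        ≤ volume (comb m ∩ Ico a b ∪ Ico (a - h) a) := by
          refine measure_mono fun x hx => ?_
          simp only [mem_inter_iff, mem_Ico, mem_union] at hx ⊢
          by_cases hxa : a ≤ x
          · exact Or.inl ⟨hx.1, hxa, by linarith [hx.2.2]⟩
          · exact Or.inr ⟨hx.2.1, lt_of_not_ge hxa⟩
      _ ≤ v + volume (Ico (a - h) a) := measure_union_le _ _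
      _ = v + ENNReal.ofReal h := by rw [hvolh.1]
  have h4 : v ≤ volume (comb m ∩ Ico (a - h) (b - h)) + ENNReal.ofReal h := by
    calc v ≤ volume (comb m ∩ Ico (a - h) (b - h) ∪ Ico (b - h) b) := by
          refine measure_mono fun x hx => ?_
          simp only [mem_inter_iff, mem_Ico, mem_union] at hx ⊢
          by_cases hxb : x < b - h
          · exact Or.inl ⟨hx.1, by linarith [hx.2.1], hxb⟩
          · exact Or.inr ⟨le_of_not_gt hxb, hx.2.2⟩
      _ ≤ volume (comb m ∩ Ico (a - h) (b - h)) + volume (Ico (b - h) b) := measure_union_le _ _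
      _ = _ := by rw [hvolh.2]
  rw [hh, ofReal_inv_natCast hm] at h3 h4
  rw [← h2] at h3 h4
  constructor
  · calc 2 * v = v + v := two_mul v
      _ ≤ v + (v' + (m : ℝ≥0∞)⁻¹) := add_le_add le_rfl h4
      _ = (v + v') + (m : ℝ≥0∞)⁻¹ := (add_assoc _ _ _).symm
      _ = ENNReal.ofReal (b - a) + (m : ℝ≥0∞)⁻¹ := by rw [h1]
  · calc ENNReal.ofReal (b - a) = v + v' := h1.symm
      _ ≤ v + (v + (m : ℝ≥0∞)⁻¹) := add_le_add le_rfl h3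
      _ = 2 * v + (m : ℝ≥0∞)⁻¹ := by rw [← add_assoc, two_mul]

/-- The comb of order `m` fills at most half of a tooth of order `n`, up to `1/(2m)`. [folklore] -/
private theorem two_mul_volume_tooth_inter_comb_le {n m : ℕ} (hn : 0 < n) (hm : 0 < m) {j : ℕ} (hj : j < n) :
    2 * volume (tooth n j ∩ comb m) ≤ (n : ℝ≥0∞)⁻¹ + (m : ℝ≥0∞)⁻¹ := by
  have hn' : (0 : ℝ) < n := by exact_mod_cast hn
  have hj' : (j : ℝ) + 1 ≤ n := by exact_mod_cast hj
  have := (comb_equidistribution hm (a := 2 * (j : ℝ) / n) (b := (2 * (j : ℝ) + 1) / n)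
    (by positivity) (by rw [div_le_iff₀ hn']; linarith)).1
  rw [inter_comm] at this
  rw [show ((2 * (j : ℝ) + 1) / n - 2 * (j : ℝ) / n) = (n : ℝ)⁻¹ by field_simp; ring,
    ofReal_inv_natCast hn] at this
  exact this

/-- The comb of order `m` fills at least half of a gap of order `n`, up to `1/(2m)`. [folklore] -/
private theorem inv_le_two_mul_volume_gap_inter_comb {n m : ℕ} (hn : 0 < n) (hm : 0 < m) {j : ℕ} (hj : j < n) :
    (n : ℝ≥0∞)⁻¹ ≤ 2 * volume (gap n j ∩ comb m) + (m : ℝ≥0∞)⁻¹ := by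
  have hn' : (0 : ℝ) < n := by exact_mod_cast hn
  have hj' : (j : ℝ) + 1 ≤ n := by exact_mod_cast hj
  have := (comb_equidistribution hm (a := (2 * (j : ℝ) + 1) / n) (b := (2 * (j : ℝ) + 2) / n)
    (by positivity) (by rw [div_le_iff₀ hn']; linarith)).2
  rw [inter_comm] at this
  rw [show ((2 * (j : ℝ) + 2) / n - (2 * (j : ℝ) + 1) / n) = (n : ℝ)⁻¹ by field_simp; ring,
    ofReal_inv_natCast hn] at this
  exact this

/-! ### §3 Two combs of very different orders are far apart in `L¹[0, 2]` -/

/-- **No Cauchy property.** For `n, m ≥ 1`: `1 ≤ n/m + vol((comb_n Δ comb_m) ∩ [0,2))` — inside each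
tooth of `comb_n` the comb of order `m` misses about half, inside each gap it fills about half.
[folklore] -/
private theorem one_le_add_volume_comb_symmDiff {n m : ℕ} (hn : 0 < n) (hm : 0 < m) :
    1 ≤ (n : ℝ≥0∞) * (m : ℝ≥0∞)⁻¹ + volume ((comb n ∆ comb m) ∩ Ico (0 : ℝ) 2) := by
  classical
  -- the pieces
  set P : ℕ → Set ℝ := fun j => (tooth n j \ comb m) ∪ (gap n j ∩ comb m) with hP
  have hPmeas : ∀ j, MeasurableSet (P j) := fun j =>
    ((measurableSet_tooth n j).diff (measurableSet_comb m)).union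
      ((measurableSet_gap n j).inter (measurableSet_comb m))
  have hPblock : ∀ j, P j ⊆ block n j := fun j =>
    union_subset (fun x hx => tooth_subset_block n j hx.1)
      (inter_subset_left.trans (gap_subset_block n j))
  have hPD : ∀ j, j < n → P j ⊆ (comb n ∆ comb m) ∩ Ico 0 2 := by
    intro j hj x hx
    have htooth : tooth n j ⊆ comb n := by
      intro y hy
      simp only [comb, mem_iUnion, Finset.mem_range, exists_prop]
      exact ⟨j, hj, hy⟩
    rcases hx with ⟨hx1, hx2⟩ | ⟨hx1, hx2⟩
    · exact ⟨Set.mem_symmDiff.2 (Or.inl ⟨htooth hx1, hx2⟩), tooth_subset hj hx1⟩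
    · refine ⟨Set.mem_symmDiff.2 (Or.inr ⟨hx2, ?_⟩), gap_subset hj hx1⟩
      exact Set.disjoint_right.1 (disjoint_comb_gap hn j) hx1
  -- per piece: `n⁻¹ + n⁻¹ ≤ (m⁻¹ + m⁻¹) + 2 vol (P j)`
  have hpiece : ∀ j, j < n →
      (n : ℝ≥0∞)⁻¹ + (n : ℝ≥0∞)⁻¹ ≤ ((m : ℝ≥0∞)⁻¹ + (m : ℝ≥0∞)⁻¹) + 2 * volume (P j) := by
    intro j hj
    have hvol : volume (P j) = volume (tooth n j \ comb m) + volume (gap n j ∩ comb m) := by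
      rw [hP]
      exact measure_union (Disjoint.mono (fun x hx => hx.1) inter_subset_left (disjoint_tooth_gap hn j j))
        ((measurableSet_gap n j).inter (measurableSet_comb m))
    have hsplit : volume (tooth n j ∩ comb m) + volume (tooth n j \ comb m) = (n : ℝ≥0∞)⁻¹ := by
      rw [measure_inter_add_sdiff _ (measurableSet_comb m), volume_tooth hn]
    have hA := two_mul_volume_tooth_inter_comb_le hn hm hj
    have hB := inv_le_two_mul_volume_gap_inter_comb hn hm hj
    have hne : (n : ℝ≥0∞)⁻¹ ≠ ⊤ := ENNReal.inv_ne_top.2 (by exact_mod_cast hn.ne')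
    -- from `hsplit` and `hA`: `n⁻¹ + n⁻¹ ≤ (n⁻¹ + m⁻¹) + 2 vol(tooth \ comb)`, cancel one `n⁻¹`
    have hC : (n : ℝ≥0∞)⁻¹ ≤ (m : ℝ≥0∞)⁻¹ + 2 * volume (tooth n j \ comb m) := by
      have : (n : ℝ≥0∞)⁻¹ + (n : ℝ≥0∞)⁻¹ ≤
          (n : ℝ≥0∞)⁻¹ + ((m : ℝ≥0∞)⁻¹ + 2 * volume (tooth n j \ comb m)) := by
        calc (n : ℝ≥0∞)⁻¹ + (n : ℝ≥0∞)⁻¹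
            = 2 * volume (tooth n j ∩ comb m) + 2 * volume (tooth n j \ comb m) := by
              rw [← mul_add, hsplit, two_mul]
          _ ≤ ((n : ℝ≥0∞)⁻¹ + (m : ℝ≥0∞)⁻¹) + 2 * volume (tooth n j \ comb m) :=
              add_le_add hA le_rfl
          _ = _ := add_assoc _ _ _
      exact (ENNReal.add_le_add_iff_left hne).1 this
    calc (n : ℝ≥0∞)⁻¹ + (n : ℝ≥0∞)⁻¹
        ≤ ((m : ℝ≥0∞)⁻¹ + 2 * volume (tooth n j \ comb m)) +
            (2 * volume (gap n j ∩ comb m) + (m : ℝ≥0∞)⁻¹) := add_le_add hC hB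
      _ = ((m : ℝ≥0∞)⁻¹ + (m : ℝ≥0∞)⁻¹) + 2 * volume (P j) := by rw [hvol, mul_add]; ring
  -- sum over `j < n`
  have hsum := Finset.sum_le_sum fun j (hj : j ∈ Finset.range n) => hpiece j (Finset.mem_range.1 hj)
  have hL : ∑ j ∈ Finset.range n, ((n : ℝ≥0∞)⁻¹ + (n : ℝ≥0∞)⁻¹) = 2 := by
    rw [Finset.sum_const, Finset.card_range, nsmul_eq_mul, ← two_mul, ← mul_assoc, mul_comm (n : ℝ≥0∞),
      mul_assoc, ENNReal.mul_inv_cancel (by exact_mod_cast hn.ne') (ENNReal.natCast_ne_top n), mul_one]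
  have hR : ∑ j ∈ Finset.range n, (((m : ℝ≥0∞)⁻¹ + (m : ℝ≥0∞)⁻¹) + 2 * volume (P j)) =
      2 * ((n : ℝ≥0∞) * (m : ℝ≥0∞)⁻¹) + 2 * ∑ j ∈ Finset.range n, volume (P j) := by
    rw [Finset.sum_add_distrib, Finset.sum_const, Finset.card_range, nsmul_eq_mul, ← Finset.mul_sum,
      ← two_mul, ← mul_assoc, mul_comm (n : ℝ≥0∞) 2, mul_assoc]
  rw [hL, hR, ← mul_add] at hsum
  -- the pieces are disjoint and sit inside `(comb n Δ comb m) ∩ [0,2)`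
  have hdisj : (↑(Finset.range n) : Set ℕ).PairwiseDisjoint P := by
    intro j _ j' _ hjj
    exact (disjoint_block hn hjj).mono (hPblock j) (hPblock j')
  have hU : ∑ j ∈ Finset.range n, volume (P j) ≤ volume ((comb n ∆ comb m) ∩ Ico 0 2) := by
    rw [← measure_biUnion_finset hdisj fun j _ => hPmeas j]
    exact measure_mono (iUnion₂_subset fun j hj => hPD j (Finset.mem_range.1 hj))
  have h2 : (2 : ℝ≥0∞) * 1 ≤ 2 * ((n : ℝ≥0∞) * (m : ℝ≥0∞)⁻¹ + volume ((comb n ∆ comb m) ∩ Ico 0 2)) :=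
    (mul_one (2 : ℝ≥0∞)).symm ▸ hsum.trans (by gcongr)
  exact (ENNReal.mul_le_mul_iff_right two_ne_zero ENNReal.ofNat_ne_top).1 h2

/-- **The combs have no locally convergent subsequence:** no set `G ⊆ ℝ` is the local-in-measure limit
of `comb_{n_k}` along a strictly increasing `n_k` (not even on the single compact `[0, 2]`).
[folklore] -/
private theorem not_tendsto_volume_comb_symmDiff (G : Set ℝ) {nk : ℕ → ℕ} (hmono : StrictMono nk) :
    ¬ Tendsto (fun k => volume ((comb (nk k) ∆ G) ∩ Icc (0 : ℝ) 2)) atTop (𝓝 0) := by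
  intro h
  rw [ENNReal.tendsto_atTop_zero] at h
  obtain ⟨k₀, hk₀⟩ := h (ENNReal.ofReal (1 / 8)) (ENNReal.ofReal_pos.2 (by norm_num))
  have hid : ∀ k, k ≤ nk k := fun k => hmono.id_le k
  set k₁ := max k₀ 1 with hk₁
  set n := nk k₁ with hn_def
  have hn : 0 < n := lt_of_lt_of_le (lt_of_lt_of_le Nat.one_pos (le_max_right _ _)) (hid k₁)
  set k₂ := max k₁ (4 * n) with hk₂
  set m := nk k₂ with hm_def
  have h4nm : 4 * n ≤ m := le_trans (le_max_right _ _) (hid k₂)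
  have hm : 0 < m := lt_of_lt_of_le (by omega) h4nm
  have hB := one_le_add_volume_comb_symmDiff hn hm
  -- the two approximation errors
  have e1 : volume ((comb n ∆ G) ∩ Icc (0 : ℝ) 2) ≤ ENNReal.ofReal (1 / 8) := hk₀ k₁ (le_max_left _ _)
  have e2 : volume ((comb m ∆ G) ∩ Icc (0 : ℝ) 2) ≤ ENNReal.ofReal (1 / 8) :=
    hk₀ k₂ (le_trans (le_max_left _ _) (le_max_left _ _))
  have htri : volume ((comb n ∆ comb m) ∩ Ico (0 : ℝ) 2) ≤
      ENNReal.ofReal (1 / 8) + ENNReal.ofReal (1 / 8) := by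
    calc volume ((comb n ∆ comb m) ∩ Ico (0 : ℝ) 2)
        ≤ volume (((comb n ∆ G) ∩ Icc (0 : ℝ) 2) ∪ ((comb m ∆ G) ∩ Icc (0 : ℝ) 2)) := by
          refine measure_mono fun x hx => ?_
          have hx2 : x ∈ Icc (0 : ℝ) 2 := Ico_subset_Icc_self hx.2
          rcases Set.mem_symmDiff.1 hx.1 with ⟨h1, h2⟩ | ⟨h1, h2⟩
          · by_cases hG : x ∈ G
            · exact Or.inr ⟨Set.mem_symmDiff.2 (Or.inr ⟨hG, h2⟩), hx2⟩
            · exact Or.inl ⟨Set.mem_symmDiff.2 (Or.inl ⟨h1, hG⟩), hx2⟩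
          · by_cases hG : x ∈ G
            · exact Or.inl ⟨Set.mem_symmDiff.2 (Or.inr ⟨hG, h2⟩), hx2⟩
            · exact Or.inr ⟨Set.mem_symmDiff.2 (Or.inl ⟨h1, hG⟩), hx2⟩
      _ ≤ _ := measure_union_le _ _
      _ ≤ ENNReal.ofReal (1 / 8) + ENNReal.ofReal (1 / 8) := add_le_add e1 e2
  have hratio : (n : ℝ≥0∞) * (m : ℝ≥0∞)⁻¹ ≤ ENNReal.ofReal (1 / 4) := by
    have hm' : (0 : ℝ) < m := by exact_mod_cast hm
    have h4nm' : 4 * (n : ℝ) ≤ m := by exact_mod_cast h4nm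
    rw [← ENNReal.ofReal_natCast n, ← ENNReal.ofReal_natCast m, ← ENNReal.ofReal_inv_of_pos hm',
      ← ENNReal.ofReal_mul (Nat.cast_nonneg n)]
    refine ENNReal.ofReal_le_ofReal ?_
    rw [← div_eq_mul_inv, div_le_iff₀ hm']
    linarith
  have : (1 : ℝ≥0∞) ≤ ENNReal.ofReal (1 / 4) + (ENNReal.ofReal (1 / 8) + ENNReal.ofReal (1 / 8)) :=
    hB.trans (add_le_add hratio htri)
  rw [← ENNReal.ofReal_add (by norm_num) (by norm_num), ← ENNReal.ofReal_add (by norm_num) (by norm_num),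
    ENNReal.one_le_ofReal] at this
  norm_num at this


/-! ### §4 Transport to `ℝ¹ = EuclideanSpace ℝ (Fin 1)` and the data of the counterexample -/

/-- The coordinate map `ℝ¹ ≃ᵐ ℝ`, `x ↦ x 0` (the `WithLp` identification followed by evaluation at
the unique index). [folklore] -/
def coord : EuclideanSpace ℝ (Fin 1) ≃ᵐ ℝ :=
  (MeasurableEquiv.toLp 2 (Fin 1 → ℝ)).symm.trans (MeasurableEquiv.funUnique (Fin 1) ℝ)

/-- Helper. [folklore] -/
private theorem coord_apply (x : EuclideanSpace ℝ (Fin 1)) : coord x = x 0 := rfl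

/-- Helper. [folklore] -/
private theorem coord_symm_apply (r : ℝ) (i : Fin 1) : coord.symm r i = r := rfl

/-- `coord` preserves Lebesgue measure. [folklore] -/
private theorem measurePreserving_coord : MeasurePreserving coord volume volume :=
  (EuclideanSpace.volume_preserving_symm_measurableEquiv_toLp (Fin 1)).trans
    (volume_preserving_funUnique (Fin 1) ℝ)

/-- Hence (outer) Lebesgue measure of EVERY set is transported: `vol(coord⁻¹ T) = vol T`. [folklore] -/
private theorem volume_preimage_coord (T : Set ℝ) : volume (coord ⁻¹' T) = volume T := by
  rw [← MeasurableEquiv.map_apply coord T, measurePreserving_coord.map_eq]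

/-- The slab `{x : 0 ≤ x 0 ≤ 2}` is compact. [folklore] -/
private theorem isCompact_preimage_coord_Icc : IsCompact (coord ⁻¹' Icc (0 : ℝ) 2) := by
  have hc : Continuous fun x : EuclideanSpace ℝ (Fin 1) => x 0 := (EuclideanSpace.proj (0 : Fin 1)).continuous
  refine Metric.isCompact_of_isClosed_isBounded (isClosed_Icc.preimage hc) ?_
  rw [Metric.isBounded_iff_subset_closedBall (0 : EuclideanSpace ℝ (Fin 1))]
  refine ⟨2, fun x hx => ?_⟩
  rw [mem_preimage, coord_apply, mem_Icc] at hx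
  rw [mem_closedBall, dist_zero_right, EuclideanSpace.norm_eq, Fin.sum_univ_one, Real.norm_eq_abs,
    sq_abs, Real.sqrt_sq_eq_abs, abs_of_nonneg hx.1]
  exact hx.2

/-- The reference lattice datum of the counterexample: `M = id` on `ℝ¹` (so `𝓛 = ℤ`, `det 𝓛 = 1`).
[folklore] -/
abbrev idMap : EuclideanSpace ℝ (Fin 1) ≃ₗ[ℝ] EuclideanSpace ℝ (Fin 1) := LinearEquiv.refl ℝ _

/-- The basis vector `e = 1 ∈ ℝ¹`. [folklore] -/
def unitVec : EuclideanSpace ℝ (Fin 1) := EuclideanSpace.single 0 1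

/-- Helper. [folklore] -/
private theorem coord_symm_eq (r : ℝ) : coord.symm r = r • unitVec := by
  ext i
  fin_cases i
  simp [coord_symm_apply, unitVec]

/-- Helper. [folklore] -/
private theorem range_basis_eq : Set.range (fun i : Fin 1 => idMap (EuclideanSpace.single i (1 : ℝ))) = {unitVec} := by
  ext x
  simp only [Set.mem_range, LinearEquiv.refl_apply, mem_singleton_iff, unitVec]
  constructor
  · rintro ⟨i, rfl⟩; rw [Fin.fin_one_eq_zero i]
  · rintro rfl; exact ⟨0, rfl⟩

/-- Helper. [folklore] -/
private theorem bravaisLattice_idMap :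
    bravaisLattice idMap = (Submodule.span ℤ ({unitVec} : Set (EuclideanSpace ℝ (Fin 1))) : Set _) := by
  rw [bravaisLattice, range_basis_eq]

/-- Integer multiples of `e` are lattice points. [folklore] -/
private theorem zsmul_unitVec_mem (k : ℤ) : (k : ℝ) • unitVec ∈ bravaisLattice idMap := by
  rw [bravaisLattice_idMap, SetLike.mem_coe, Submodule.mem_span_singleton]
  exact ⟨k, by rw [← Int.cast_smul_eq_zsmul ℝ]⟩

/-- **The loophole.** The ZERO potential with "support set" `𝒩 = {e}` satisfies every field of
`IsFiniteRangePotential` (which only asks `V = 0` OFF `𝒩`, never `V < 0` ON `𝒩`).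
[cite: DelNinPetrache2022, §1.1 (p. 3): "V vanishes outside of a finite subset 𝒩 ⊂ 𝓛 such that span_ℤ 𝒩 = 𝓛"] -/
theorem isFiniteRangePotential_zero :
    IsFiniteRangePotential idMap (fun _ => (0 : ℝ)) ({unitVec} : Finset (EuclideanSpace ℝ (Fin 1))) where
  nonpos := fun _ => le_rfl
  eq_zero := fun _ _ => rfl
  subset := by
    rw [Finset.coe_singleton, singleton_subset_iff]
    simpa using zsmul_unitVec_mem 1
  span_eq := by rw [Finset.coe_singleton, bravaisLattice_idMap]

/-- The zero potential has zero missing-bond energy on every configuration. [folklore] -/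
private theorem surfaceEnergy_zero_potential (L : Set (EuclideanSpace ℝ (Fin 1)))
    (X : Finset (EuclideanSpace ℝ (Fin 1))) : surfaceEnergy L (fun _ => (0 : ℝ)) X = 0 := by
  simp [surfaceEnergy]

/-- The comb configuration `X_n = {0, 2, 4, …, 2(n−1)} ⊂ ℤ = 𝓛`. [folklore] -/
def combConfig (n : ℕ) : Finset (EuclideanSpace ℝ (Fin 1)) :=
  (Finset.range n).image fun j : ℕ => coord.symm (2 * (j : ℝ))

/-- Helper. [folklore] -/
private theorem card_combConfig (n : ℕ) : (combConfig n).card = n := by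
  rw [combConfig, Finset.card_image_of_injective _ fun j j' h => ?_, Finset.card_range]
  have := congrArg coord h
  simp only [MeasurableEquiv.apply_symm_apply] at this
  exact_mod_cast (mul_right_injective₀ (two_ne_zero' ℝ) this : (j : ℝ) = j')

/-- Helper. [folklore] -/
private theorem combConfig_subset (n : ℕ) :
    (↑(combConfig n) : Set (EuclideanSpace ℝ (Fin 1))) ⊆ bravaisLattice idMap := by
  intro x hx
  rw [Finset.mem_coe, combConfig, Finset.mem_image] at hx
  obtain ⟨j, -, rfl⟩ := hx
  rw [coord_symm_eq]
  have := zsmul_unitVec_mem (2 * j)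
  push_cast at this
  exact this

/-- **The rescaled cell sets of the comb configurations are the combs:** `E_n(X_n) = {x : x 0 ∈ comb_n}`.
[cite: DelNinPetrache2022, §1.1 (1.4) (p. 3)] -/
theorem cellSet_combConfig (n : ℕ) : cellSet idMap n (combConfig n) = coord ⁻¹' comb n := by
  rcases Nat.eq_zero_or_pos n with rfl | hn
  · simp [cellSet, combConfig, comb]
  have hn' : (0 : ℝ) < n := by exact_mod_cast hn
  have hexp : ((n : ℝ) ^ (-(1 : ℝ) / ((1 : ℕ) : ℝ))) = (n : ℝ)⁻¹ := by
    rw [Nat.cast_one, div_one, Real.rpow_neg_one]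
  have hcell : fundamentalCell idMap = {y : EuclideanSpace ℝ (Fin 1) | 0 ≤ y 0 ∧ y 0 < 1} := by
    rw [fundamentalCell]
    ext y
    simp only [Set.mem_image, LinearEquiv.refl_apply, exists_eq_right, mem_setOf_eq, Fin.forall_fin_one]
  ext z
  rw [cellSet, hexp, Set.mem_smul_set_iff_inv_smul_mem₀ (inv_ne_zero hn'.ne'), inv_inv, mem_preimage,
    coord_apply]
  simp only [mem_iUnion, exists_prop, combConfig, Finset.mem_image, Finset.mem_range, comb, tooth,
    mem_Ico, hcell]
  constructor
  · rintro ⟨x, ⟨j, hj, rfl⟩, hz⟩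
    rw [Set.mem_vadd_set_iff_neg_vadd_mem, vadd_eq_add, mem_setOf_eq] at hz
    have h0 : (-coord.symm (2 * (j : ℝ)) + (n : ℝ) • z) 0 = -(2 * j) + n * z 0 := by
      simp [coord_symm_apply]
    rw [h0] at hz
    refine ⟨j, hj, ?_, ?_⟩
    · rw [div_le_iff₀ hn']; linarith [hz.1]
    · rw [lt_div_iff₀ hn']; linarith [hz.2]
  · rintro ⟨j, hj, h1, h2⟩
    refine ⟨coord.symm (2 * (j : ℝ)), ⟨j, hj, rfl⟩, ?_⟩
    rw [Set.mem_vadd_set_iff_neg_vadd_mem, vadd_eq_add, mem_setOf_eq]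
    have h0 : (-coord.symm (2 * (j : ℝ)) + (n : ℝ) • z) 0 = -(2 * j) + n * z 0 := by
      simp [coord_symm_apply]
    rw [h0]
    rw [div_le_iff₀ hn'] at h1
    rw [lt_div_iff₀ hn'] at h2
    constructor <;> linarith

/-! ### §5 The refutation -/

/-- Preimages commute with symmetric differences. [folklore] -/
private theorem preimage_symmDiff {α β : Type*} (f : α → β) (s t : Set β) :
    f ⁻¹' (s ∆ t) = (f ⁻¹' s) ∆ (f ⁻¹' t) := by
  simp only [Set.symmDiff_def, preimage_union, Set.preimage_sdiff]

/-- **`DelNinPetrache2022_compactness` (Del Nin–Petrache 2022, Proposition 1.2 AS TYPED) is false.**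
Witness: `d = 1`, `𝓛 = ℤ` (`M = id`), `𝒩 = {1}`, the zero potential `V ≡ 0` (admitted by
`IsFiniteRangePotential`, `isFiniteRangePotential_zero`), the comb configurations
`X_n = {0, 2, …, 2n − 2}` (`𝓕(X_n) = 0 ≤ 0 · n⁰`): their rescaled cell sets `E_n(X_n)` are the combs
`comb_n` (`cellSet_combConfig`), and no subsequence of the combs converges locally in measure to
any set (`not_tendsto_volume_comb_symmDiff`, tested on the compact `{0 ≤ x 0 ≤ 2}`).  The printed
proof (Lemma 2.5, p. 11) assumes "`V(v) < 0` for every `v ∈ 𝒩`", which the printed statement of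
Proposition 1.2 (p. 3–4) and its transcription omit; the corrected statement is vendored as
`DelNinPetrache2022_compactness'` in `FiniteRangeLatticeGammaLimit.lean`.
[cite: DelNinPetrache2022, Proposition 1.2 (p. 3–4); Lemma 2.5 (p. 11)] -/
theorem compactness_false : ¬ DelNinPetrache2022_compactness := by
  intro h
  have hX : ∀ n, (↑(combConfig n) : Set (EuclideanSpace ℝ (Fin 1))) ⊆ bravaisLattice idMap ∧
      (combConfig n).card = n := fun n => ⟨combConfig_subset n, card_combConfig n⟩
  obtain ⟨nk, E, hmono, -, hconv⟩ := h 1 idMap (fun _ => (0 : ℝ)) {unitVec} le_rfl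
    isFiniteRangePotential_zero combConfig 0 hX (fun n => by rw [surfaceEnergy_zero_potential, zero_mul])
  have ht := hconv (coord ⁻¹' Icc 0 2) isCompact_preimage_coord_Icc
  have hE : E = coord ⁻¹' (coord '' E) := (Set.preimage_image_eq E coord.injective).symm
  have hset : ∀ k, (cellSet idMap (nk k) (combConfig (nk k)) ∆ E) ∩ coord ⁻¹' Icc (0 : ℝ) 2 =
      coord ⁻¹' ((comb (nk k) ∆ (coord '' E)) ∩ Icc (0 : ℝ) 2) := by
    intro k
    rw [cellSet_combConfig, preimage_inter, preimage_symmDiff, ← hE]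
  simp_rw [hset, volume_preimage_coord] at ht
  exact not_tendsto_volume_comb_symmDiff (coord '' E) hmono ht

/-! ### §6 A lower bound for the perimeter of a slab `{a ≤ x 0 < b}` of `ℝ¹` -/

/-- The slab `{x : a ≤ x 0 < b} = coord⁻¹' [a, b)`. [folklore] -/
def slab (a b : ℝ) : Set (EuclideanSpace ℝ (Fin 1)) := coord ⁻¹' Ico a b

/-- Helper. [folklore] -/
private theorem measurableSet_slab (a b : ℝ) : MeasurableSet (slab a b) :=
  measurableSet_Ico.preimage coord.measurable

/-- Helper. [folklore] -/
private theorem continuous_coord : Continuous (coord : EuclideanSpace ℝ (Fin 1) → ℝ) :=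
  (EuclideanSpace.proj (0 : Fin 1)).continuous

/-- Helper. [folklore] -/
private theorem closure_slab_subset (a b : ℝ) : closure (slab a b) ⊆ coord ⁻¹' Icc a b :=
  closure_minimal (preimage_mono Ico_subset_Icc_self) (isClosed_Icc.preimage continuous_coord)

/-- Helper. [folklore] -/
private theorem unitVec_apply : unitVec 0 = 1 := by simp [unitVec]

/-- Helper. [folklore] -/
private theorem norm_unitVec : ‖unitVec‖ = 1 := by
  rw [unitVec, PiLp.norm_single, norm_one]

/-- Helper. [folklore] -/
private theorem dist_coord_symm (s t : ℝ) : dist (coord.symm s) (coord.symm t) = |s - t| := by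
  rw [coord_symm_eq, coord_symm_eq, dist_eq_norm, ← sub_smul, norm_smul, norm_unitVec, mul_one,
    Real.norm_eq_abs]

/-- **Every slab of positive width has perimeter at least `1`** — tested against the field
`x ↦ β(x) e` for a smooth bump `β` centred at `b e` that vanishes at `a e`: its divergence integrates over
the slab to `β(b e) − β(a e) = 1` (fundamental theorem of calculus along the axis). [folklore] -/
private theorem one_le_perimeter_slab {a b : ℝ} (hab : a < b) : 1 ≤ perimeter (slab a b) := by
  -- the bump
  obtain ⟨β, hβout⟩ : ∃ β : ContDiffBump (coord.symm b), β.rOut = (b - a) / 2 :=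
    ⟨⟨(b - a) / 4, (b - a) / 2, by linarith, by linarith⟩, rfl⟩
  set φ : EuclideanSpace ℝ (Fin 1) → EuclideanSpace ℝ (Fin 1) := fun x => (β x) • unitVec with hφ
  have hβd : Differentiable ℝ (β : EuclideanSpace ℝ (Fin 1) → ℝ) :=
    (β.contDiff (n := 1)).differentiable one_ne_zero
  -- admissibility
  have hunit : IsUnitTestField φ := by
    refine ⟨(β.contDiff (n := 1)).smul contDiff_const, ?_, fun x => ?_⟩
    · show HasCompactSupport ((⇑β) • fun _ : EuclideanSpace ℝ (Fin 1) => unitVec)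
      exact β.hasCompactSupport.smul_right
    · rw [hφ]
      dsimp only
      rw [norm_smul, norm_unitVec, mul_one, Real.norm_of_nonneg (β.nonneg)]
      exact β.le_one
  -- the divergence is the axial derivative of `β`
  have hdiv : ∀ x, fieldDivergence φ x = fderiv ℝ (β : EuclideanSpace ℝ (Fin 1) → ℝ) x unitVec := by
    intro x
    rw [fieldDivergence_eq_sum (m := 0), Fin.sum_univ_one, hφ, fderiv_smul_const (hβd x)]
    simp [unitVec]
  -- transport the integral to `ℝ` and evaluate it by the fundamental theorem of calculus
  set F : ℝ → ℝ := fun t => β (coord.symm t) with hF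
  set G : ℝ → ℝ := fun t => fderiv ℝ (β : EuclideanSpace ℝ (Fin 1) → ℝ) (coord.symm t) unitVec with hG
  have hderiv : ∀ t, HasDerivAt F (G t) t := by
    intro t
    have h1 : HasDerivAt (fun s : ℝ => coord.symm s) unitVec t := by
      have : (fun s : ℝ => coord.symm s) = fun s => s • unitVec := funext coord_symm_eq
      rw [this]
      simpa using (hasDerivAt_id t).smul_const unitVec
    exact (hβd (coord.symm t)).hasFDerivAt.comp_hasDerivAt t h1
  have hGc : Continuous G := by
    have hc : Continuous fun s : ℝ => coord.symm s := by
      have : (fun s : ℝ => coord.symm s) = fun s => s • unitVec := funext coord_symm_eq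
      rw [this]; exact continuous_id.smul continuous_const
    exact (((β.contDiff (n := 1)).continuous_fderiv one_ne_zero).comp hc).clm_apply continuous_const
  have hint : ∫ x in slab a b, fieldDivergence φ x = 1 := by
    simp_rw [hdiv]
    have h1 : ∫ x in slab a b, fderiv ℝ (β : EuclideanSpace ℝ (Fin 1) → ℝ) x unitVec =
        ∫ x in coord ⁻¹' Ico a b, G (coord x) := by
      refine setIntegral_congr_fun (measurableSet_slab a b) fun x _ => ?_
      rw [hG]
      dsimp only
      rw [MeasurableEquiv.symm_apply_apply]
    rw [h1, measurePreserving_coord.setIntegral_preimage_emb coord.measurableEmbedding,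
      integral_Ico_eq_integral_Ioc, ← intervalIntegral.integral_of_le hab.le,
      intervalIntegral.integral_eq_sub_of_hasDerivAt (fun t _ => hderiv t) (hGc.intervalIntegrable _ _)]
    -- `F b = 1`, `F a = 0`
    have hFb : F b = 1 := by
      rw [hF]
      exact β.one_of_mem_closedBall (Metric.mem_closedBall_self β.rIn_pos.le)
    have hFa : F a = 0 := by
      rw [hF]
      refine β.zero_of_le_dist ?_
      rw [hβout, dist_coord_symm, abs_of_nonpos (by linarith)]
      linarith
    rw [hFb, hFa, sub_zero]
  have := le_perimeter (A := slab a b) hunit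
  rwa [hint, ENNReal.ofReal_one] at this

/-! ### §7 A bounded set of infinite perimeter in `ℝ¹`: the dyadic staircase `⋃_i [2^{−i−1}, (5/4)2^{−i−1})` -/

/-- Left endpoints `l_i = 2^{−i−1}`. [folklore] -/
def lEnd (i : ℕ) : ℝ := (1 / 2 : ℝ) ^ (i + 1)

/-- Right endpoints `r_i = (5/4) 2^{−i−1}`. [folklore] -/
def rEnd (i : ℕ) : ℝ := 5 / 4 * (1 / 2 : ℝ) ^ (i + 1)

/-- Helper. [folklore] -/
private theorem lEnd_pos (i : ℕ) : 0 < lEnd i := by unfold lEnd; positivity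

/-- Helper. [folklore] -/
private theorem lEnd_lt_rEnd (i : ℕ) : lEnd i < rEnd i := by
  unfold lEnd rEnd; linarith [pow_pos (by norm_num : (0 : ℝ) < 1 / 2) (i + 1)]

/-- Helper. [folklore] -/
private theorem lEnd_anti {i j : ℕ} (hij : i ≤ j) : lEnd j ≤ lEnd i := by
  unfold lEnd
  exact pow_le_pow_of_le_one (by norm_num) (by norm_num) (by omega)

/-- `r_j < l_i` for `i < j`: the intervals are separated and accumulate at `0`. [folklore] -/
private theorem rEnd_lt_lEnd {i j : ℕ} (hij : i < j) : rEnd j < lEnd i := by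
  unfold rEnd lEnd
  have h1 : (1 / 2 : ℝ) ^ (j + 1) ≤ (1 / 2 : ℝ) ^ (i + 2) :=
    pow_le_pow_of_le_one (by norm_num) (by norm_num) (by omega)
  have h2 : (1 / 2 : ℝ) ^ (i + 2) = 1 / 2 * (1 / 2 : ℝ) ^ (i + 1) := by rw [pow_succ]; ring
  have h3 : (0 : ℝ) < (1 / 2 : ℝ) ^ (i + 1) := by positivity
  rw [h2] at h1
  linarith

/-- Helper. [folklore] -/
private theorem rEnd_le (i : ℕ) : rEnd i ≤ 5 / 8 := by
  have := lEnd_anti (Nat.zero_le i)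
  unfold lEnd at this; unfold rEnd
  norm_num at this ⊢
  linarith

/-- The `i`-th step `J_i = [l_i, r_i)`. [folklore] -/
def step (i : ℕ) : Set ℝ := Ico (lEnd i) (rEnd i)

/-- The dyadic staircase `⋃_i J_i ⊆ (0, 5/8]`. [folklore] -/
def staircase : Set ℝ := ⋃ i, step i

/-- The bad set `{x : x 0 ∈ ⋃_i J_i} ⊆ ℝ¹`: bounded, measurable, of INFINITE perimeter. [folklore] -/
def badSet : Set (EuclideanSpace ℝ (Fin 1)) := coord ⁻¹' staircase

/-- Helper. [folklore] -/
private theorem measurableSet_staircase : MeasurableSet staircase :=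
  MeasurableSet.iUnion fun _ => measurableSet_Ico

/-- Helper. [folklore] -/
private theorem measurableSet_badSet : MeasurableSet badSet :=
  measurableSet_staircase.preimage coord.measurable

/-- Head/tail splitting of the staircase at level `m`. [folklore] -/
private theorem badSet_eq_union (m : ℕ) :
    badSet = (⋃ i ∈ Finset.range m, slab (lEnd i) (rEnd i)) ∪ coord ⁻¹' ⋃ i, step (i + m) := by
  ext x
  simp only [badSet, staircase, slab, mem_preimage, mem_iUnion, mem_union, Finset.mem_range, exists_prop,
    step]
  constructor
  · rintro ⟨i, hi⟩
    by_cases him : i < m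
    · exact Or.inl ⟨i, him, hi⟩
    · refine Or.inr ⟨i - m, ?_⟩
      rwa [Nat.sub_add_cancel (not_lt.1 him)]
  · rintro (⟨i, -, hi⟩ | ⟨i, hi⟩)
    · exact ⟨i, hi⟩
    · exact ⟨i + m, hi⟩

/-- The head lies in `{l_{m−1} ≤ x 0 ≤ 1}` (closed), the tail in `{0 ≤ x 0 ≤ r_m}` (closed), and
`r_m < l_{m−1}`… stated with the bounds `(1/2)^m ≤ ·` and `· ≤ (5/8)(1/2)^m`. [folklore] -/
private theorem disjoint_closure_head_tail (m : ℕ) :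
    Disjoint (closure (⋃ i ∈ Finset.range m, slab (lEnd i) (rEnd i)))
      (closure (coord ⁻¹' ⋃ i, step (i + m))) := by
  have hc := continuous_coord
  -- closed supersets
  have hH : closure (⋃ i ∈ Finset.range m, slab (lEnd i) (rEnd i)) ⊆ coord ⁻¹' Ici ((1 / 2 : ℝ) ^ m) := by
    refine closure_minimal ?_ (isClosed_Ici.preimage hc)
    intro x hx
    simp only [mem_iUnion, Finset.mem_range, exists_prop, slab, mem_preimage, mem_Ico] at hx
    obtain ⟨i, hi, hx1, _⟩ := hx
    have : (1 / 2 : ℝ) ^ m ≤ lEnd i := by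
      unfold lEnd; exact pow_le_pow_of_le_one (by norm_num) (by norm_num) (by omega)
    exact le_trans this hx1
  have hT : closure (coord ⁻¹' ⋃ i, step (i + m)) ⊆ coord ⁻¹' Iic (5 / 8 * (1 / 2 : ℝ) ^ m) := by
    refine closure_minimal ?_ (isClosed_Iic.preimage hc)
    intro x hx
    simp only [mem_preimage, mem_iUnion, step, mem_Ico] at hx
    obtain ⟨i, _, hx2⟩ := hx
    have : rEnd (i + m) ≤ 5 / 8 * (1 / 2 : ℝ) ^ m := by
      unfold rEnd
      have ha : (1 / 2 : ℝ) ^ (i + m + 1) ≤ (1 / 2 : ℝ) ^ (m + 1) :=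
        pow_le_pow_of_le_one (by norm_num) (by norm_num) (by omega)
      have hb : (1 / 2 : ℝ) ^ (m + 1) = 1 / 2 * (1 / 2 : ℝ) ^ m := by rw [pow_succ]; ring
      rw [hb] at ha
      linarith
    exact le_trans hx2.le this
  refine Disjoint.mono hH hT ?_
  rw [Set.disjoint_iff]
  rintro x ⟨h1, h2⟩
  rw [mem_preimage, mem_Ici] at h1
  rw [mem_preimage, mem_Iic] at h2
  have : (0 : ℝ) < (1 / 2 : ℝ) ^ m := by positivity
  linarith

/-- The steps of the head have pairwise disjoint closures. [folklore] -/
private theorem pairwise_disjoint_closure_slab (m : ℕ) :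
    (↑(Finset.range m) : Set ℕ).Pairwise fun i j =>
      Disjoint (closure (slab (lEnd i) (rEnd i))) (closure (slab (lEnd j) (rEnd j))) := by
  intro i _ j _ hij
  refine Disjoint.mono (closure_slab_subset _ _) (closure_slab_subset _ _) ?_
  rw [Set.disjoint_iff]
  rintro x ⟨h1, h2⟩
  rw [mem_preimage, mem_Icc] at h1 h2
  rcases lt_or_gt_of_ne hij with h | h
  · have := rEnd_lt_lEnd h; linarith [h1.1, h2.2]
  · have := rEnd_lt_lEnd h; linarith [h2.1, h1.2]

/-- **The bad set has infinite perimeter:** for every `m`, splitting off the first `m` steps (at positive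
distance from the rest) gives `Per ≥ Σ_{i<m} Per(slab_i) ≥ m`. [folklore] -/
private theorem natCast_le_perimeter_badSet (m : ℕ) : (m : ℝ≥0∞) ≤ perimeter badSet := by
  have hmeasH : ∀ i ∈ Finset.range m, MeasurableSet (slab (lEnd i) (rEnd i)) :=
    fun i _ => measurableSet_slab _ _
  have hmeasT : MeasurableSet (coord ⁻¹' ⋃ i, step (i + m)) :=
    (MeasurableSet.iUnion fun _ => measurableSet_Ico).preimage coord.measurable
  rw [badSet_eq_union m,
    Literature.Analysis.Convexity.perimeter_union_eq_add_of_disjoint_closure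
      (Finset.measurableSet_biUnion _ hmeasH) hmeasT (disjoint_closure_head_tail m),
    Literature.Analysis.Convexity.perimeter_biUnion_eq_sum_of_disjoint_closure (Finset.range m) hmeasH
      (pairwise_disjoint_closure_slab m)]
  refine le_trans ?_ (le_self_add)
  calc (m : ℝ≥0∞) = ∑ i ∈ Finset.range m, (1 : ℝ≥0∞) := by simp
    _ ≤ ∑ i ∈ Finset.range m, perimeter (slab (lEnd i) (rEnd i)) :=
        Finset.sum_le_sum fun i _ => one_le_perimeter_slab (lEnd_lt_rEnd i)

/-- Helper. [folklore] -/
private theorem perimeter_badSet : perimeter badSet = ⊤ := by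
  by_contra h
  obtain ⟨m, hm⟩ := ENNReal.exists_nat_gt h
  exact absurd (natCast_le_perimeter_badSet m) (not_le.2 hm)

/-- The bad set is not a set of finite perimeter. [folklore] -/
private theorem not_hasFinitePerimeter_badSet : ¬ HasFinitePerimeter badSet := fun h =>
  (lt_top_iff_ne_top.1 h.2) perimeter_badSet

/-! ### §8 Dyadic lattice approximations of the bad set with exactly `N_k = 2^{k+2}` cells -/

/-- The scale `N_k = 2^{k+2}`. [folklore] -/
def scaleOf (k : ℕ) : ℕ := 2 ^ (k + 2)

/-- Helper. [folklore] -/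
private theorem scaleOf_pos (k : ℕ) : 0 < scaleOf k := by unfold scaleOf; positivity

/-- Helper. [folklore] -/
private theorem strictMono_scaleOf : StrictMono scaleOf := fun a b hab => by
  unfold scaleOf
  exact Nat.pow_lt_pow_right (by norm_num) (by omega)

/-- The configuration of a finite set of natural-number sites `A ⊂ ℕ ⊂ ℤ = 𝓛`. [folklore] -/
def natConfig (A : Finset ℕ) : Finset (EuclideanSpace ℝ (Fin 1)) := A.image fun a : ℕ => coord.symm a

/-- Helper. [folklore] -/
private theorem card_natConfig (A : Finset ℕ) : (natConfig A).card = A.card := by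
  rw [natConfig, Finset.card_image_of_injective _ fun a a' h => ?_]
  have := congrArg coord h
  simp only [MeasurableEquiv.apply_symm_apply] at this
  exact_mod_cast this

/-- Helper. [folklore] -/
private theorem natConfig_subset (A : Finset ℕ) :
    (↑(natConfig A) : Set (EuclideanSpace ℝ (Fin 1))) ⊆ bravaisLattice idMap := by
  intro x hx
  rw [Finset.mem_coe, natConfig, Finset.mem_image] at hx
  obtain ⟨a, -, rfl⟩ := hx
  rw [coord_symm_eq]
  have := zsmul_unitVec_mem a
  push_cast at this
  exact this

/-- **The rescaled cell set of a configuration of natural-number sites:** `E_N(X_A) = {x : x 0 ∈ ⋃_{a∈A}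
[a/N, (a+1)/N)}`. [cite: DelNinPetrache2022, §1.1 (1.4) (p. 3)] -/
theorem cellSet_natConfig {N : ℕ} (hN : 0 < N) (A : Finset ℕ) :
    cellSet idMap N (natConfig A) = coord ⁻¹' ⋃ a ∈ A, Ico ((a : ℝ) / N) (((a : ℝ) + 1) / N) := by
  have hN' : (0 : ℝ) < N := by exact_mod_cast hN
  have hexp : ((N : ℝ) ^ (-(1 : ℝ) / ((1 : ℕ) : ℝ))) = (N : ℝ)⁻¹ := by
    rw [Nat.cast_one, div_one, Real.rpow_neg_one]
  have hcell : fundamentalCell idMap = {y : EuclideanSpace ℝ (Fin 1) | 0 ≤ y 0 ∧ y 0 < 1} := by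
    rw [fundamentalCell]
    ext y
    simp only [Set.mem_image, LinearEquiv.refl_apply, exists_eq_right, mem_setOf_eq, Fin.forall_fin_one]
  ext z
  rw [cellSet, hexp, Set.mem_smul_set_iff_inv_smul_mem₀ (inv_ne_zero hN'.ne'), inv_inv, mem_preimage,
    coord_apply]
  simp only [mem_iUnion, exists_prop, natConfig, Finset.mem_image, mem_Ico, hcell]
  constructor
  · rintro ⟨x, ⟨a, ha, rfl⟩, hz⟩
    rw [Set.mem_vadd_set_iff_neg_vadd_mem, vadd_eq_add, mem_setOf_eq] at hz
    have h0 : (-coord.symm (a : ℝ) + (N : ℝ) • z) 0 = -(a : ℝ) + N * z 0 := by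
      simp [coord_symm_apply]
    rw [h0] at hz
    refine ⟨a, ha, ?_, ?_⟩
    · rw [div_le_iff₀ hN']; linarith [hz.1]
    · rw [lt_div_iff₀ hN']; linarith [hz.2]
  · rintro ⟨a, ha, h1, h2⟩
    refine ⟨coord.symm (a : ℝ), ⟨a, ha, rfl⟩, ?_⟩
    rw [Set.mem_vadd_set_iff_neg_vadd_mem, vadd_eq_add, mem_setOf_eq]
    have h0 : (-coord.symm (a : ℝ) + (N : ℝ) • z) 0 = -(a : ℝ) + N * z 0 := by
      simp [coord_symm_apply]
    rw [h0]
    rw [div_le_iff₀ hN'] at h1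
    rw [lt_div_iff₀ hN'] at h2
    constructor <;> linarith

/-- The near sites at level `k`: for each step `i < k`, the `2^{k−1−i}` cells `a ∈ [2^{k+1−i}, 2^{k+1−i} +
2^{k−1−i})`, whose rescaled cells tile `J_i` exactly. [folklore] -/
def nearIdx (k : ℕ) : Finset ℕ :=
  (Finset.range k).biUnion fun i => Finset.Ico (2 ^ (k + 1 - i)) (2 ^ (k + 1 - i) + 2 ^ (k - 1 - i))

/-- Helper. [folklore] -/
private theorem mem_nearIdx {k a : ℕ} :
    a ∈ nearIdx k ↔ ∃ i, i < k ∧ 2 ^ (k + 1 - i) ≤ a ∧ a < 2 ^ (k + 1 - i) + 2 ^ (k - 1 - i) := by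
  simp only [nearIdx, Finset.mem_biUnion, Finset.mem_range, Finset.mem_Ico]

/-- Helper. [folklore] -/
private theorem nearIdx_lt {k a : ℕ} (ha : a ∈ nearIdx k) : a < scaleOf k := by
  obtain ⟨i, hi, -, h2⟩ := mem_nearIdx.1 ha
  have h3 : 2 ^ (k + 1 - i) ≤ 2 ^ (k + 1) := Nat.pow_le_pow_right (by norm_num) (by omega)
  have h4 : 2 ^ (k - 1 - i) ≤ 2 ^ (k + 1) := Nat.pow_le_pow_right (by norm_num) (by omega)
  have h5 : scaleOf k = 2 ^ (k + 1) + 2 ^ (k + 1) := by unfold scaleOf; rw [pow_succ]; ring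
  omega

/-- Helper. [folklore] -/
private theorem card_nearIdx_le (k : ℕ) : (nearIdx k).card ≤ scaleOf k := by
  calc (nearIdx k).card ≤ (Finset.range (scaleOf k)).card :=
        Finset.card_le_card fun a ha => Finset.mem_range.2 (nearIdx_lt ha)
    _ = scaleOf k := Finset.card_range _

/-- The far sites (padding to reach exactly `N_k` points): `N_k − #near` consecutive cells starting at
`N_k²`. [folklore] -/
def farIdx (k : ℕ) : Finset ℕ :=
  Finset.Ico (scaleOf k ^ 2) (scaleOf k ^ 2 + (scaleOf k - (nearIdx k).card))

/-- All sites at level `k`. [folklore] -/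
def idx (k : ℕ) : Finset ℕ := nearIdx k ∪ farIdx k

/-- Helper. [folklore] -/
private theorem le_of_mem_farIdx {k a : ℕ} (ha : a ∈ farIdx k) : scaleOf k ^ 2 ≤ a :=
  (Finset.mem_Ico.1 ha).1

/-- Helper. [folklore] -/
private theorem disjoint_near_far (k : ℕ) : Disjoint (nearIdx k) (farIdx k) := by
  rw [Finset.disjoint_left]
  intro a ha hfar
  have h1 := nearIdx_lt ha
  have h2 := le_of_mem_farIdx hfar
  have h3 : scaleOf k ≤ scaleOf k ^ 2 := by
    rw [sq]; exact Nat.le_mul_of_pos_left _ (scaleOf_pos k)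
  omega

/-- Helper. [folklore] -/
private theorem card_idx (k : ℕ) : (idx k).card = scaleOf k := by
  rw [idx, Finset.card_union_of_disjoint (disjoint_near_far k), farIdx, Nat.card_Ico]
  have := card_nearIdx_le k
  omega

/-- The staircase configuration at level `k`: `N_k` lattice points. [folklore] -/
def staircaseConfig (k : ℕ) : Finset (EuclideanSpace ℝ (Fin 1)) := natConfig (idx k)

/-- Helper. [folklore] -/
private theorem card_staircaseConfig (k : ℕ) : (staircaseConfig k).card = scaleOf k := by
  rw [staircaseConfig, card_natConfig, card_idx]

/-- Power bookkeeping: `N_k · l_i = 2^{k+1−i}` for `i < k`. [folklore] -/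
private theorem scaleOf_mul_lEnd {k i : ℕ} (hi : i < k) : (scaleOf k : ℝ) * lEnd i = (2 : ℝ) ^ (k + 1 - i) := by
  unfold scaleOf lEnd
  push_cast
  have : k + 2 = (k + 1 - i) + (i + 1) := by omega
  rw [this, pow_add, one_div_pow, mul_assoc, mul_one_div_cancel (by positivity), mul_one]

/-- Power bookkeeping: `N_k · r_i = 2^{k+1−i} + 2^{k−1−i}` for `i < k`. [folklore] -/
private theorem scaleOf_mul_rEnd {k i : ℕ} (hi : i < k) :
    (scaleOf k : ℝ) * rEnd i = (2 : ℝ) ^ (k + 1 - i) + (2 : ℝ) ^ (k - 1 - i) := by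
  have h1 : (scaleOf k : ℝ) * rEnd i = 5 / 4 * ((scaleOf k : ℝ) * lEnd i) := by unfold rEnd lEnd; ring
  rw [h1, scaleOf_mul_lEnd hi]
  have : k + 1 - i = (k - 1 - i) + 2 := by omega
  rw [this, pow_add]
  ring

/-- Near cells lie inside their step. [folklore] -/
private theorem near_cell_subset {k a : ℕ} (ha : a ∈ nearIdx k) :
    Ico ((a : ℝ) / scaleOf k) (((a : ℝ) + 1) / scaleOf k) ⊆ staircase := by
  obtain ⟨i, hi, h1, h2⟩ := mem_nearIdx.1 ha
  have hN : (0 : ℝ) < scaleOf k := by exact_mod_cast scaleOf_pos k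
  have h1' : (2 : ℝ) ^ (k + 1 - i) ≤ a := by exact_mod_cast h1
  have h2' : (a : ℝ) + 1 ≤ (2 : ℝ) ^ (k + 1 - i) + (2 : ℝ) ^ (k - 1 - i) := by exact_mod_cast h2
  intro t ht
  rw [mem_Ico] at ht
  simp only [staircase, mem_iUnion, step, mem_Ico]
  refine ⟨i, ?_, ?_⟩
  · -- `l_i ≤ a / N ≤ t`
    have : lEnd i ≤ (a : ℝ) / scaleOf k := by
      rw [le_div_iff₀ hN, mul_comm, scaleOf_mul_lEnd hi]; exact h1'
    exact this.trans ht.1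
  · have : ((a : ℝ) + 1) / scaleOf k ≤ rEnd i := by
      rw [div_le_iff₀ hN, mul_comm, scaleOf_mul_rEnd hi]; exact h2'
    exact lt_of_lt_of_le ht.2 this

/-- The steps `J_i`, `i < k`, are tiled by near cells. [folklore] -/
private theorem step_subset_near {k i : ℕ} (hi : i < k) {t : ℝ} (ht : t ∈ step i) :
    ∃ a ∈ nearIdx k, t ∈ Ico ((a : ℝ) / scaleOf k) (((a : ℝ) + 1) / scaleOf k) := by
  have hN : (0 : ℝ) < scaleOf k := by exact_mod_cast scaleOf_pos k
  rw [step, mem_Ico] at ht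
  have ht0 : 0 ≤ t := (lEnd_pos i).le.trans ht.1
  have hNt : 0 ≤ (scaleOf k : ℝ) * t := mul_nonneg hN.le ht0
  set a : ℕ := ⌊(scaleOf k : ℝ) * t⌋₊ with ha
  have ha1 : (a : ℝ) ≤ scaleOf k * t := Nat.floor_le hNt
  have ha2 : (scaleOf k : ℝ) * t < a + 1 := Nat.lt_floor_add_one _
  refine ⟨a, mem_nearIdx.2 ⟨i, hi, ?_, ?_⟩, ?_, ?_⟩
  · have : (2 : ℝ) ^ (k + 1 - i) ≤ scaleOf k * t := by
      rw [← scaleOf_mul_lEnd hi]; exact mul_le_mul_of_nonneg_left ht.1 hN.le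
    have : ((2 ^ (k + 1 - i) : ℕ) : ℝ) ≤ scaleOf k * t := by push_cast; exact this
    exact Nat.le_floor this
  · have : (scaleOf k : ℝ) * t < (2 : ℝ) ^ (k + 1 - i) + (2 : ℝ) ^ (k - 1 - i) := by
      rw [← scaleOf_mul_rEnd hi]; exact mul_lt_mul_of_pos_left ht.2 hN
    have h' : (scaleOf k : ℝ) * t < ((2 ^ (k + 1 - i) + 2 ^ (k - 1 - i) : ℕ) : ℝ) := by push_cast; exact this
    exact (Nat.floor_lt hNt).2 h'
  · rw [div_le_iff₀ hN]; linarith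
  · rw [lt_div_iff₀ hN]; linarith

/-- The tail `⋃_{i ≥ k} J_i` lies in `[0, (1/2)^k)`. [folklore] -/
private theorem step_subset_Ico {k i : ℕ} (hi : k ≤ i) : step i ⊆ Ico 0 ((1 / 2 : ℝ) ^ k) := by
  intro t ht
  rw [step, mem_Ico] at ht
  refine ⟨(lEnd_pos i).le.trans ht.1, lt_of_lt_of_le ht.2 ?_⟩
  unfold rEnd
  have ha : (1 / 2 : ℝ) ^ (i + 1) ≤ (1 / 2 : ℝ) ^ (k + 1) :=
    pow_le_pow_of_le_one (by norm_num) (by norm_num) (by omega)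
  have hb : (1 / 2 : ℝ) ^ (k + 1) = 1 / 2 * (1 / 2 : ℝ) ^ k := by rw [pow_succ]; ring
  rw [hb] at ha
  have hk : (0 : ℝ) < (1 / 2 : ℝ) ^ k := by positivity
  linarith

/-- **The approximation is good on bounded windows:** on `{|x 0| ≤ ρ}` with `ρ < N_k` the symmetric
difference of the `k`-th rescaled cell set and the bad set lies in `{0 ≤ x 0 < 2^{−k}}`. [folklore] -/
private theorem symmDiff_inter_subset {k : ℕ} {ρ : ℝ} (hρ : ρ < scaleOf k) :
    (cellSet idMap (scaleOf k) (staircaseConfig k) ∆ badSet) ∩ coord ⁻¹' Icc (-ρ) ρ ⊆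
      coord ⁻¹' Ico 0 ((1 / 2 : ℝ) ^ k) := by
  have hN : (0 : ℝ) < scaleOf k := by exact_mod_cast scaleOf_pos k
  rw [staircaseConfig, cellSet_natConfig (scaleOf_pos k)]
  rintro x ⟨hx, hxK⟩
  rw [mem_preimage, mem_Icc] at hxK
  rw [mem_preimage]
  rcases Set.mem_symmDiff.1 hx with ⟨h1, h2⟩ | ⟨h1, h2⟩
  · -- in a cell, not in the bad set: the cell is a far cell, contradiction with the window
    exfalso
    rw [mem_preimage, mem_iUnion₂] at h1
    obtain ⟨a, ha, hta⟩ := h1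
    rw [idx, Finset.mem_union] at ha
    rcases ha with ha | ha
    · exact h2 (near_cell_subset ha hta)
    · have hfar : (scaleOf k : ℝ) ^ 2 ≤ a := by exact_mod_cast le_of_mem_farIdx ha
      rw [mem_Ico] at hta
      have h3 : (scaleOf k : ℝ) ≤ (a : ℝ) / scaleOf k := by
        rw [le_div_iff₀ hN, ← sq]; exact hfar
      linarith [hta.1, hxK.2]
  · -- in the bad set, not in any cell: must be in the tail
    rw [badSet, mem_preimage, staircase, mem_iUnion] at h1
    obtain ⟨i, hi⟩ := h1
    by_cases hik : i < k
    · exfalso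
      obtain ⟨a, ha, hta⟩ := step_subset_near hik hi
      exact h2 (mem_preimage.2 (mem_iUnion₂.2 ⟨a, Finset.mem_union_left _ ha, hta⟩))
    · exact step_subset_Ico (not_lt.1 hik) hi

/-- **The rescaled staircase configurations converge locally in measure to the bad set.**
[cite: DelNinPetrache2022, §1.1 (p. 3)] -/
theorem locallyConvergesInMeasure_staircase :
    LocallyConvergesInMeasure (fun k => cellSet idMap (scaleOf k) (staircaseConfig k)) badSet := by
  intro K hK
  -- a window containing `K`
  obtain ⟨ρ, hρ⟩ := (Metric.isBounded_iff_subset_closedBall (0 : EuclideanSpace ℝ (Fin 1))).1 hK.isBounded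
  have hKw : K ⊆ coord ⁻¹' Icc (-ρ) ρ := by
    intro x hx
    have h := hρ hx
    rw [mem_closedBall, dist_zero_right, EuclideanSpace.norm_eq, Fin.sum_univ_one, Real.norm_eq_abs,
      sq_abs, Real.sqrt_sq_eq_abs] at h
    rw [mem_preimage, coord_apply, mem_Icc]
    exact abs_le.1 h
  -- squeeze between `0` and `2^{-k}`
  have hup : Tendsto (fun k : ℕ => ENNReal.ofReal ((1 / 2 : ℝ) ^ k)) atTop (𝓝 0) := by
    rw [← ENNReal.ofReal_zero]
    exact ENNReal.tendsto_ofReal (tendsto_pow_atTop_nhds_zero_of_lt_one (by norm_num) (by norm_num))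
  refine tendsto_of_tendsto_of_tendsto_of_le_of_le' tendsto_const_nhds hup
    (Eventually.of_forall fun _ => zero_le) ?_
  filter_upwards [eventually_ge_atTop ⌈ρ⌉₊] with k hk
  have hρk : ρ < scaleOf k := by
    have h1 : ρ ≤ k := (Nat.le_ceil ρ).trans (by exact_mod_cast hk)
    have h2 : (k : ℝ) < scaleOf k := by
      unfold scaleOf
      exact_mod_cast (Nat.lt_two_pow_self).trans (Nat.pow_lt_pow_right (by norm_num) (by omega))
    linarith
  calc volume ((cellSet idMap (scaleOf k) (staircaseConfig k) ∆ badSet) ∩ K)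
      ≤ volume ((cellSet idMap (scaleOf k) (staircaseConfig k) ∆ badSet) ∩ coord ⁻¹' Icc (-ρ) ρ) :=
        measure_mono (inter_subset_inter_right _ hKw)
    _ ≤ volume (coord ⁻¹' Ico 0 ((1 / 2 : ℝ) ^ k)) := measure_mono (symmDiff_inter_subset hρk)
    _ = ENNReal.ofReal ((1 / 2 : ℝ) ^ k) := by rw [volume_preimage_coord, Real.volume_Ico, sub_zero]

/-! ### §9 The refutation of the `Γ`-liminf clause as typed -/

/-- **`DelNinPetrache2022_liminf` (Del Nin–Petrache 2022, Theorem 1.1, `Γ`-liminf clause AS TYPED) is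
false.**  Witness: `d = 1`, `𝓛 = ℤ`, `𝒩 = {1}`, `V ≡ 0` (admitted by `IsFiniteRangePotential`), the
bad set `E` = `badSet` (an `L¹_loc`-limit of rescaled cell sets with exactly `N_k = 2^{k+2}` cells,
`locallyConvergesInMeasure_staircase`, yet of INFINITE perimeter, so `crystallinePerimeter _ E = ⊤`),
while every energy `𝓕(X_k)` vanishes: the inequality would read `⊤ ≤ 0`.  The corrected statement
(with Lemma 2.5's "`V < 0` on `𝒩`") is `DelNinPetrache2022_liminf'` in `FiniteRangeLatticeGammaLimit.lean`.
[cite: DelNinPetrache2022, Theorem 1.1 (p. 3); Lemma 2.5 (p. 11)] -/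
theorem liminf_false : ¬ DelNinPetrache2022_liminf := by
  intro h
  have hX : ∀ k, (↑(staircaseConfig k) : Set (EuclideanSpace ℝ (Fin 1))) ⊆ bravaisLattice idMap ∧
      (staircaseConfig k).card = scaleOf k := fun k => ⟨natConfig_subset _, card_staircaseConfig k⟩
  have hle := h 1 idMap (fun _ => (0 : ℝ)) {unitVec} le_rfl isFiniteRangePotential_zero badSet scaleOf
    staircaseConfig strictMono_scaleOf hX locallyConvergesInMeasure_staircase
  rw [crystallinePerimeter_of_not not_hasFinitePerimeter_badSet] at hle
  simp_rw [surfaceEnergy_zero_potential, mul_zero, ENNReal.ofReal_zero, liminf_const] at hle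
  exact absurd hle (not_le.2 ENNReal.zero_lt_top)

end DelNinPetrache2022

/-- Root-level alias in the file's path namespace, in the tree's `<Fact>_false` convention
(cf. `FlatleyTheil2015.FlatleyTheil2015_thm11_false`, `Theil2006_periodicGroundStates_false`).
[cite: DelNinPetrache2022, Proposition 1.2 (p. 3–4); Lemma 2.5 (p. 11)] -/
theorem DelNinPetrache2022.DelNinPetrache2022_compactness_false :
    ¬ DelNinPetrache2022.DelNinPetrache2022_compactness :=
  DelNinPetrache2022.compactness_false

/-- Root-level alias of `DelNinPetrache2022.liminf_false` in the `<Fact>_false` convention.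
[cite: DelNinPetrache2022, Theorem 1.1 (p. 3); Lemma 2.5 (p. 11)] -/
theorem DelNinPetrache2022.DelNinPetrache2022_liminf_false :
    ¬ DelNinPetrache2022.DelNinPetrache2022_liminf :=
  DelNinPetrache2022.liminf_false

namespace DelNinPetrache2022

end Literature.MathematicalPhysics.StatisticalMechanics.DelNinPetrache2022

end
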